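import Mathlib
import Summits.Ventures.PercRepro2.HCov
import Summits.Ventures.PercRepro2.BasePendant
import Summits.Ventures.PercRepro2.PendantRoot
import Summits.Ventures.PercRepro2.RootLeafA3Events
import Summits.Ventures.PercRepro2.RootLeafA3

/-!
# A ROOT as a leaf at `o`, part 1: the two worlds of the leaf edge and the `PD` / `T` / `T′` masses
(blind cell PercRepro2, p4 g2; S3 GAP (G4), proofs/subclaims/S3-CLASSES.md §S3.10 (G4-o))

The root `a₁` is a LEAF attached to `o` by the single edge `f` (`q = p f`), `a₂, a₃, b ≠ a₁`.
On `{f closed}` the root is isolated (`Q` sure, `C₁ = {a₁}`, `PD = {a₃ ↮ a₂}`, `T = {a₂ ↔ a₃}`,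
`T′ = ∅`, the (ONE-ROOT) world); on `{f open}` the root is `o` (`Q = {o ↮ a₂}`,
`PD = PDEvent o a₂ a₃`, `T = TEvent o a₂ a₃`, `T′ = TEvent a₂ o a₃`: the coincidence `a₁ = o`).
The `Q`-masses and the connection masses are the generic lemmas of `RootLeafA3Events` /
`RootLeafA3` with the attachment vertex `o` in place of `a₃`; this file carries the pointwise
two-world lemmas for `PD`, `T`, `T′` and their `q`-mixtures (`RootLeafA3.prob_split`).
-/

namespace Summit.Ventures.PercRepro2

open UnionCluster CovForm PendantRoot

namespace RootLeafO

variable {V : Type*} {E : Type*} [Fintype E] [DecidableEq E] {R : Type*} [Field R]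
  [LinearOrder R] [IsStrictOrderedRing R]

/-! ## The two worlds of the leaf edge, pointwise -/

section Pointwise

variable {ends : E → Sym2 V} {f : E} {a₁ o : V}

omit [Fintype E] [DecidableEq E] in
/-- On `{f open}`, `PD(a₁) = PD(o)`. -/
lemma mem_PD_open (hf : ends f = s(a₁, o)) (a₂ a₃ : V) {ω : Config E} (hω : ω f = true) :
    ω ∈ PDEvent ends a₁ a₂ a₃ ↔ ω ∈ PDEvent ends o a₂ a₃ := by
  simp only [PDEvent, Dtilde, inU, Set.mem_inter_iff, Set.mem_compl_iff, Set.mem_union,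
    RootLeafA3.mem_connL_open hf a₂ hω, RootLeafA3.mem_connR_open hf a₃ hω]

omit [Fintype E] [DecidableEq E] in
/-- On `{f closed}`, `PD = {a₃ ↮ a₂}`. -/
lemma mem_PD_closed (hf : ends f = s(a₁, o)) (hleaf : ∀ e, a₁ ∈ ends e → e = f) (h1o : a₁ ≠ o)
    {a₂ a₃ : V} (h12 : a₁ ≠ a₂) (h13 : a₁ ≠ a₃) {ω : Config E} (hω : ω f = false) :
    ω ∈ PDEvent ends a₁ a₂ a₃ ↔ ω ∈ avoidAll ends a₂ {a₃} := by
  have h1 := RootLeafA3.mem_connL_closed hf hleaf h1o (Ne.symm h12) hω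
  have h2 := RootLeafA3.mem_connR_closed hf hleaf h1o (Ne.symm h13) hω
  simp only [PDEvent, Dtilde, inU, Set.mem_inter_iff, Set.mem_compl_iff, Set.mem_union,
    avoidAll_eq_compl, h1, h2, false_or, not_false_eq_true, true_and]

omit [Fintype E] [DecidableEq E] in
/-- On `{f open}`, `T(a₁) = T(o)`. -/
lemma mem_T_open (hf : ends f = s(a₁, o)) (a₂ a₃ : V) {ω : Config E} (hω : ω f = true) :
    ω ∈ TEvent ends a₁ a₂ a₃ ↔ ω ∈ TEvent ends o a₂ a₃ := by
  simp only [TEvent, Set.mem_inter_iff, Set.mem_compl_iff, RootLeafA3.mem_connR_open hf a₂ hω]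

omit [Fintype E] [DecidableEq E] in
/-- On `{f closed}`, `T = {a₂ ↔ a₃}`. -/
lemma mem_T_closed (hf : ends f = s(a₁, o)) (hleaf : ∀ e, a₁ ∈ ends e → e = f) (h1o : a₁ ≠ o)
    {a₂ : V} (h12 : a₁ ≠ a₂) (a₃ : V) {ω : Config E} (hω : ω f = false) :
    ω ∈ TEvent ends a₁ a₂ a₃ ↔ ω ∈ connEvent ends a₂ a₃ := by
  have h1 := RootLeafA3.mem_connR_closed hf hleaf h1o (Ne.symm h12) hω
  simp only [TEvent, Set.mem_inter_iff, Set.mem_compl_iff, h1, not_false_eq_true, true_and]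

omit [Fintype E] [DecidableEq E] in
/-- On `{f open}`, `T′(a₁) = T′(o)`. -/
lemma mem_T'_open (hf : ends f = s(a₁, o)) (a₂ a₃ : V) {ω : Config E} (hω : ω f = true) :
    ω ∈ TEvent ends a₂ a₁ a₃ ↔ ω ∈ TEvent ends a₂ o a₃ := by
  simp only [TEvent, Set.mem_inter_iff, Set.mem_compl_iff, RootLeafA3.mem_connL_open hf a₂ hω,
    RootLeafA3.mem_connL_open hf a₃ hω]

omit [Fintype E] [DecidableEq E] in
/-- `T′` is empty on `{f closed}`. -/
lemma mem_T'_closed (hf : ends f = s(a₁, o)) (hleaf : ∀ e, a₁ ∈ ends e → e = f) (h1o : a₁ ≠ o)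
    (a₂ : V) {a₃ : V} (h13 : a₁ ≠ a₃) {ω : Config E} (hω : ω f = false) :
    ω ∉ TEvent ends a₂ a₁ a₃ :=
  fun h => RootLeafA3.mem_connL_closed hf hleaf h1o (Ne.symm h13) hω h.2

end Pointwise

/-! ## Free events of the two worlds -/

section Free

variable {ends : E → Sym2 V} {f : E} {a₁ o : V} (hf : ends f = s(a₁, o))
  (hleaf : ∀ e, a₁ ∈ ends e → e = f) (h1o : a₁ ≠ o) {a₂ a₃ : V} (h12 : a₁ ≠ a₂) (h13 : a₁ ≠ a₃)

omit [Fintype E] [DecidableEq E] in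
/-- Free events are closed under union. -/
lemma Free.union' {A B : Set (Config E)} (hA : Free f A) (hB : Free f B) : Free f (A ∪ B) := by
  have := dependsOn_union hA hB
  rwa [Set.union_self] at this

include hf hleaf h1o h12 h13

omit [Fintype E] [DecidableEq E] in
/-- `PD(o) = PDEvent o a₂ a₃` is free of the leaf edge. -/
lemma free_PD1 : Free f (PDEvent ends o a₂ a₃) := by
  unfold PDEvent Dtilde inU
  exact (free_connEvent hf hleaf h1o (Ne.symm h1o) (Ne.symm h12)).compl.inter
    ((Free.union' (free_connEvent hf hleaf h1o (Ne.symm h13) (Ne.symm h1o))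
      (free_connEvent hf hleaf h1o (Ne.symm h13) (Ne.symm h12))).compl)

omit [Fintype E] [DecidableEq E] in
/-- `T(o) = TEvent o a₂ a₃` is free of the leaf edge. -/
lemma free_T1 : Free f (TEvent ends o a₂ a₃) := by
  unfold TEvent
  exact (free_connEvent hf hleaf h1o (Ne.symm h12) (Ne.symm h1o)).compl.inter
    (free_connEvent hf hleaf h1o (Ne.symm h12) (Ne.symm h13))

omit [Fintype E] [DecidableEq E] in
/-- `T′(o) = TEvent a₂ o a₃` is free of the leaf edge. -/
lemma free_T'1 : Free f (TEvent ends a₂ o a₃) := by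
  unfold TEvent
  exact (free_connEvent hf hleaf h1o (Ne.symm h1o) (Ne.symm h12)).compl.inter
    (free_connEvent hf hleaf h1o (Ne.symm h1o) (Ne.symm h13))

omit [Fintype E] [DecidableEq E] in
/-- `{a₃ ↮ a₂}` is free of the leaf edge. -/
lemma free_N3 : Free f (avoidAll ends a₂ {a₃}) := by
  rw [avoidAll_eq_compl]
  exact (free_connEvent hf hleaf h1o (Ne.symm h13) (Ne.symm h12)).compl

omit [Fintype E] [DecidableEq E] in
/-- `{a₂ ↔ a₃}` is free of the leaf edge. -/
lemma free_H3 : Free f (connEvent ends a₂ a₃) :=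
  free_connEvent hf hleaf h1o (Ne.symm h12) (Ne.symm h13)

end Free

/-! ## The mixtures of the `PD` / `T` / `T′` masses -/

section Masses

variable (p : E → R) {ends : E → Sym2 V} {f : E} {a₁ o : V} (hf : ends f = s(a₁, o))
  (hleaf : ∀ e, a₁ ∈ ends e → e = f) (h1o : a₁ ≠ o) {a₂ a₃ : V} (h12 : a₁ ≠ a₂) (h13 : a₁ ≠ a₃)

include hf hleaf h1o h12 h13

omit [LinearOrder R] [IsStrictOrderedRing R] in
/-- `P(PD ∩ X) = q P(PD(o) ∩ X) + (1 − q) P({a₃ ↮ a₂} ∩ X)` for free `X`. -/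
lemma prob_PD_inter {X : Set (Config E)} (hX : Free f X) :
    prob p (PDEvent ends a₁ a₂ a₃ ∩ X) =
      p f * prob p (PDEvent ends o a₂ a₃ ∩ X) + (1 - p f) * prob p (avoidAll ends a₂ {a₃} ∩ X) := by
  refine RootLeafA3.prob_split p ((free_PD1 hf hleaf h1o h12 h13).inter hX)
    ((free_N3 hf hleaf h1o h12 h13).inter hX) ?_ ?_
  · ext ω
    simp only [Set.mem_inter_iff, mem_openEdge]
    constructor <;> rintro ⟨⟨h, hx⟩, hω⟩ <;>
      exact ⟨⟨by simpa only [mem_PD_open hf a₂ a₃ hω] using h, hx⟩, hω⟩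
  · ext ω
    simp only [Set.mem_inter_iff, mem_closedEdge]
    constructor <;> rintro ⟨⟨h, hx⟩, hω⟩ <;>
      exact ⟨⟨by simpa only [mem_PD_closed hf hleaf h1o h12 h13 hω] using h, hx⟩, hω⟩

omit [LinearOrder R] [IsStrictOrderedRing R] in
/-- `P(PD) = q P(PD(o)) + (1 − q) P(a₃ ↮ a₂)`. -/
lemma prob_PD : prob p (PDEvent ends a₁ a₂ a₃) =
    p f * prob p (PDEvent ends o a₂ a₃) + (1 - p f) * prob p (avoidAll ends a₂ {a₃}) := by
  have h := prob_PD_inter p hf hleaf h1o h12 h13 (X := Set.univ) (by intro ω ω' _; rfl)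
  simpa only [Set.inter_univ] using h

omit [LinearOrder R] [IsStrictOrderedRing R] in
/-- `P(PD ∩ {a₁ ↔ v} ∩ X) = q P(PD(o) ∩ {o ↔ v} ∩ X)` for free `X`, `v ≠ a₁`. -/
lemma prob_PD_inter_L {v : V} (hv : v ≠ a₁) {X : Set (Config E)} (hX : Free f X) :
    prob p (PDEvent ends a₁ a₂ a₃ ∩ (connEvent ends a₁ v ∩ X)) =
      p f * prob p (PDEvent ends o a₂ a₃ ∩ (connEvent ends o v ∩ X)) := by
  have h := RootLeafA3.prob_split p (A := PDEvent ends a₁ a₂ a₃ ∩ (connEvent ends a₁ v ∩ X))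
    ((free_PD1 hf hleaf h1o h12 h13).inter
      ((free_connEvent hf hleaf h1o (Ne.symm h1o) hv).inter hX)) (A₀ := ∅)
    (by intro ω ω' _; rfl) ?_ ?_
  · rw [h, prob_empty, mul_zero, add_zero]
  · ext ω
    simp only [Set.mem_inter_iff, mem_openEdge]
    constructor <;> rintro ⟨⟨h, hc, hx⟩, hω⟩ <;>
      exact ⟨⟨by simpa only [mem_PD_open hf a₂ a₃ hω] using h,
        by simpa only [RootLeafA3.mem_connL_open hf v hω] using hc, hx⟩, hω⟩
  · ext ω
    simp only [Set.mem_inter_iff, mem_closedEdge, Set.mem_empty_iff_false, false_and,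
      iff_false, not_and]
    intro h hω
    exact RootLeafA3.mem_connL_closed hf hleaf h1o hv hω h.2.1

omit [LinearOrder R] [IsStrictOrderedRing R] in
/-- `P(PD ∩ X ∩ {a₁ ↔ v}) = q P(PD(o) ∩ X ∩ {o ↔ v})`. -/
lemma prob_PD_inter_R {v : V} (hv : v ≠ a₁) {X : Set (Config E)} (hX : Free f X) :
    prob p (PDEvent ends a₁ a₂ a₃ ∩ (X ∩ connEvent ends a₁ v)) =
      p f * prob p (PDEvent ends o a₂ a₃ ∩ (X ∩ connEvent ends o v)) := by
  rw [Set.inter_comm X, Set.inter_comm X]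
  exact prob_PD_inter_L p hf hleaf h1o h12 h13 hv hX

omit [LinearOrder R] [IsStrictOrderedRing R] in
/-- `P(PD ∩ {a₁ ↔ v}) = q P(PD(o) ∩ {o ↔ v})`. -/
lemma prob_PD_inter_L₀ {v : V} (hv : v ≠ a₁) :
    prob p (PDEvent ends a₁ a₂ a₃ ∩ connEvent ends a₁ v) =
      p f * prob p (PDEvent ends o a₂ a₃ ∩ connEvent ends o v) := by
  have h := prob_PD_inter_L p hf hleaf h1o h12 h13 hv (X := Set.univ) (by intro ω ω' _; rfl)
  simpa only [Set.inter_univ] using h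

omit [LinearOrder R] [IsStrictOrderedRing R] in
/-- `P(PD ∩ {a₁ ↔ u} ∩ {a₁ ↔ v}) = q P(PD(o) ∩ {o ↔ u} ∩ {o ↔ v})`. -/
lemma prob_PD_inter_LL {u v : V} (hu : u ≠ a₁) (hv : v ≠ a₁) :
    prob p (PDEvent ends a₁ a₂ a₃ ∩ (connEvent ends a₁ u ∩ connEvent ends a₁ v)) =
      p f * prob p (PDEvent ends o a₂ a₃ ∩ (connEvent ends o u ∩ connEvent ends o v)) := by
  have h := RootLeafA3.prob_split p
    (A := PDEvent ends a₁ a₂ a₃ ∩ (connEvent ends a₁ u ∩ connEvent ends a₁ v))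
    ((free_PD1 hf hleaf h1o h12 h13).inter
      ((free_connEvent hf hleaf h1o (Ne.symm h1o) hu).inter
        (free_connEvent hf hleaf h1o (Ne.symm h1o) hv))) (A₀ := ∅)
    (by intro ω ω' _; rfl) ?_ ?_
  · rw [h, prob_empty, mul_zero, add_zero]
  · ext ω
    simp only [Set.mem_inter_iff, mem_openEdge]
    constructor <;> rintro ⟨⟨h, hcu, hcv⟩, hω⟩ <;>
      exact ⟨⟨by simpa only [mem_PD_open hf a₂ a₃ hω] using h,
        by simpa only [RootLeafA3.mem_connL_open hf u hω] using hcu,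
        by simpa only [RootLeafA3.mem_connL_open hf v hω] using hcv⟩, hω⟩
  · ext ω
    simp only [Set.mem_inter_iff, mem_closedEdge, Set.mem_empty_iff_false, false_and,
      iff_false, not_and]
    intro h hω
    exact RootLeafA3.mem_connL_closed hf hleaf h1o hu hω h.2.1

omit [LinearOrder R] [IsStrictOrderedRing R] in
/-- `P(T ∩ X) = q P(T(o) ∩ X) + (1 − q) P({a₂ ↔ a₃} ∩ X)` for free `X`. -/
lemma prob_T_inter {X : Set (Config E)} (hX : Free f X) :
    prob p (TEvent ends a₁ a₂ a₃ ∩ X) =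
      p f * prob p (TEvent ends o a₂ a₃ ∩ X) + (1 - p f) * prob p (connEvent ends a₂ a₃ ∩ X) := by
  refine RootLeafA3.prob_split p ((free_T1 hf hleaf h1o h12 h13).inter hX)
    ((free_H3 hf hleaf h1o h12 h13).inter hX) ?_ ?_
  · ext ω
    simp only [Set.mem_inter_iff, mem_openEdge]
    constructor <;> rintro ⟨⟨h, hx⟩, hω⟩ <;>
      exact ⟨⟨by simpa only [mem_T_open hf a₂ a₃ hω] using h, hx⟩, hω⟩
  · ext ω
    simp only [Set.mem_inter_iff, mem_closedEdge]
    constructor <;> rintro ⟨⟨h, hx⟩, hω⟩ <;>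
      exact ⟨⟨by simpa only [mem_T_closed hf hleaf h1o h12 a₃ hω] using h, hx⟩, hω⟩

omit [LinearOrder R] [IsStrictOrderedRing R] in
/-- `P(T) = q P(T(o)) + (1 − q) P(a₂ ↔ a₃)`. -/
lemma prob_T : prob p (TEvent ends a₁ a₂ a₃) =
    p f * prob p (TEvent ends o a₂ a₃) + (1 - p f) * prob p (connEvent ends a₂ a₃) := by
  have h := prob_T_inter p hf hleaf h1o h12 h13 (X := Set.univ) (by intro ω ω' _; rfl)
  simpa only [Set.inter_univ] using h

omit [LinearOrder R] [IsStrictOrderedRing R] in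
/-- `P(T ∩ {a₁ ↔ v} ∩ X) = q P(T(o) ∩ {o ↔ v} ∩ X)` for free `X`, `v ≠ a₁`. -/
lemma prob_T_inter_L {v : V} (hv : v ≠ a₁) {X : Set (Config E)} (hX : Free f X) :
    prob p (TEvent ends a₁ a₂ a₃ ∩ (connEvent ends a₁ v ∩ X)) =
      p f * prob p (TEvent ends o a₂ a₃ ∩ (connEvent ends o v ∩ X)) := by
  have h := RootLeafA3.prob_split p (A := TEvent ends a₁ a₂ a₃ ∩ (connEvent ends a₁ v ∩ X))
    ((free_T1 hf hleaf h1o h12 h13).inter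
      ((free_connEvent hf hleaf h1o (Ne.symm h1o) hv).inter hX)) (A₀ := ∅)
    (by intro ω ω' _; rfl) ?_ ?_
  · rw [h, prob_empty, mul_zero, add_zero]
  · ext ω
    simp only [Set.mem_inter_iff, mem_openEdge]
    constructor <;> rintro ⟨⟨h, hc, hx⟩, hω⟩ <;>
      exact ⟨⟨by simpa only [mem_T_open hf a₂ a₃ hω] using h,
        by simpa only [RootLeafA3.mem_connL_open hf v hω] using hc, hx⟩, hω⟩
  · ext ω
    simp only [Set.mem_inter_iff, mem_closedEdge, Set.mem_empty_iff_false, false_and,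
      iff_false, not_and]
    intro h hω
    exact RootLeafA3.mem_connL_closed hf hleaf h1o hv hω h.2.1

omit [LinearOrder R] [IsStrictOrderedRing R] in
/-- `P(T ∩ X ∩ {a₁ ↔ v}) = q P(T(o) ∩ X ∩ {o ↔ v})`. -/
lemma prob_T_inter_R {v : V} (hv : v ≠ a₁) {X : Set (Config E)} (hX : Free f X) :
    prob p (TEvent ends a₁ a₂ a₃ ∩ (X ∩ connEvent ends a₁ v)) =
      p f * prob p (TEvent ends o a₂ a₃ ∩ (X ∩ connEvent ends o v)) := by
  rw [Set.inter_comm X, Set.inter_comm X]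
  exact prob_T_inter_L p hf hleaf h1o h12 h13 hv hX

omit [LinearOrder R] [IsStrictOrderedRing R] in
/-- `P(T ∩ {a₁ ↔ v}) = q P(T(o) ∩ {o ↔ v})`. -/
lemma prob_T_inter_L₀ {v : V} (hv : v ≠ a₁) :
    prob p (TEvent ends a₁ a₂ a₃ ∩ connEvent ends a₁ v) =
      p f * prob p (TEvent ends o a₂ a₃ ∩ connEvent ends o v) := by
  have h := prob_T_inter_L p hf hleaf h1o h12 h13 hv (X := Set.univ) (by intro ω ω' _; rfl)
  simpa only [Set.inter_univ] using h

omit [LinearOrder R] [IsStrictOrderedRing R] in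
/-- `P(T ∩ {a₁ ↔ u} ∩ {a₁ ↔ v}) = q P(T(o) ∩ {o ↔ u} ∩ {o ↔ v})`. -/
lemma prob_T_inter_LL {u v : V} (hu : u ≠ a₁) (hv : v ≠ a₁) :
    prob p (TEvent ends a₁ a₂ a₃ ∩ (connEvent ends a₁ u ∩ connEvent ends a₁ v)) =
      p f * prob p (TEvent ends o a₂ a₃ ∩ (connEvent ends o u ∩ connEvent ends o v)) := by
  have h := RootLeafA3.prob_split p
    (A := TEvent ends a₁ a₂ a₃ ∩ (connEvent ends a₁ u ∩ connEvent ends a₁ v))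
    ((free_T1 hf hleaf h1o h12 h13).inter
      ((free_connEvent hf hleaf h1o (Ne.symm h1o) hu).inter
        (free_connEvent hf hleaf h1o (Ne.symm h1o) hv))) (A₀ := ∅)
    (by intro ω ω' _; rfl) ?_ ?_
  · rw [h, prob_empty, mul_zero, add_zero]
  · ext ω
    simp only [Set.mem_inter_iff, mem_openEdge]
    constructor <;> rintro ⟨⟨h, hcu, hcv⟩, hω⟩ <;>
      exact ⟨⟨by simpa only [mem_T_open hf a₂ a₃ hω] using h,
        by simpa only [RootLeafA3.mem_connL_open hf u hω] using hcu,
        by simpa only [RootLeafA3.mem_connL_open hf v hω] using hcv⟩, hω⟩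
  · ext ω
    simp only [Set.mem_inter_iff, mem_closedEdge, Set.mem_empty_iff_false, false_and,
      iff_false, not_and]
    intro h hω
    exact RootLeafA3.mem_connL_closed hf hleaf h1o hu hω h.2.1

omit [LinearOrder R] [IsStrictOrderedRing R] in
/-- `P(T′ ∩ X) = q P(T′(o) ∩ X)` for free `X` (`T′` is empty on `{f closed}`). -/
lemma prob_T'_inter {X : Set (Config E)} (hX : Free f X) :
    prob p (TEvent ends a₂ a₁ a₃ ∩ X) = p f * prob p (TEvent ends a₂ o a₃ ∩ X) := by
  have h := RootLeafA3.prob_split p (A := TEvent ends a₂ a₁ a₃ ∩ X)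
    ((free_T'1 hf hleaf h1o h12 h13).inter hX) (A₀ := ∅) (by intro ω ω' _; rfl) ?_ ?_
  · rw [h, prob_empty, mul_zero, add_zero]
  · ext ω
    simp only [Set.mem_inter_iff, mem_openEdge]
    constructor <;> rintro ⟨⟨h, hx⟩, hω⟩ <;>
      exact ⟨⟨by simpa only [mem_T'_open hf a₂ a₃ hω] using h, hx⟩, hω⟩
  · ext ω
    simp only [Set.mem_inter_iff, mem_closedEdge, Set.mem_empty_iff_false, false_and,
      iff_false, not_and]
    intro h hω
    exact mem_T'_closed hf hleaf h1o a₂ h13 hω h.1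

omit [LinearOrder R] [IsStrictOrderedRing R] in
/-- `P(T′) = q P(T′(o))`. -/
lemma prob_T' : prob p (TEvent ends a₂ a₁ a₃) = p f * prob p (TEvent ends a₂ o a₃) := by
  have h := prob_T'_inter p hf hleaf h1o h12 h13 (X := Set.univ) (by intro ω ω' _; rfl)
  simpa only [Set.inter_univ] using h

omit [LinearOrder R] [IsStrictOrderedRing R] in
/-- `P(T′ ∩ {a₁ ↔ v} ∩ X) = q P(T′(o) ∩ {o ↔ v} ∩ X)`. -/
lemma prob_T'_inter_L {v : V} (hv : v ≠ a₁) {X : Set (Config E)} (hX : Free f X) :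
    prob p (TEvent ends a₂ a₁ a₃ ∩ (connEvent ends a₁ v ∩ X)) =
      p f * prob p (TEvent ends a₂ o a₃ ∩ (connEvent ends o v ∩ X)) := by
  have h := RootLeafA3.prob_split p (A := TEvent ends a₂ a₁ a₃ ∩ (connEvent ends a₁ v ∩ X))
    ((free_T'1 hf hleaf h1o h12 h13).inter
      ((free_connEvent hf hleaf h1o (Ne.symm h1o) hv).inter hX)) (A₀ := ∅)
    (by intro ω ω' _; rfl) ?_ ?_
  · rw [h, prob_empty, mul_zero, add_zero]
  · ext ω
    simp only [Set.mem_inter_iff, mem_openEdge]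
    constructor <;> rintro ⟨⟨h, hc, hx⟩, hω⟩ <;>
      exact ⟨⟨by simpa only [mem_T'_open hf a₂ a₃ hω] using h,
        by simpa only [RootLeafA3.mem_connL_open hf v hω] using hc, hx⟩, hω⟩
  · ext ω
    simp only [Set.mem_inter_iff, mem_closedEdge, Set.mem_empty_iff_false, false_and,
      iff_false, not_and]
    intro h hω
    exact mem_T'_closed hf hleaf h1o a₂ h13 hω h.1

omit [LinearOrder R] [IsStrictOrderedRing R] in
/-- `P(T′ ∩ X ∩ {a₁ ↔ v}) = q P(T′(o) ∩ X ∩ {o ↔ v})`. -/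
lemma prob_T'_inter_R {v : V} (hv : v ≠ a₁) {X : Set (Config E)} (hX : Free f X) :
    prob p (TEvent ends a₂ a₁ a₃ ∩ (X ∩ connEvent ends a₁ v)) =
      p f * prob p (TEvent ends a₂ o a₃ ∩ (X ∩ connEvent ends o v)) := by
  rw [Set.inter_comm X, Set.inter_comm X]
  exact prob_T'_inter_L p hf hleaf h1o h12 h13 hv hX

omit [LinearOrder R] [IsStrictOrderedRing R] in
/-- `P(T′ ∩ {a₁ ↔ v}) = q P(T′(o) ∩ {o ↔ v})`. -/
lemma prob_T'_inter_L₀ {v : V} (hv : v ≠ a₁) :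
    prob p (TEvent ends a₂ a₁ a₃ ∩ connEvent ends a₁ v) =
      p f * prob p (TEvent ends a₂ o a₃ ∩ connEvent ends o v) := by
  have h := prob_T'_inter_L p hf hleaf h1o h12 h13 hv (X := Set.univ) (by intro ω ω' _; rfl)
  simpa only [Set.inter_univ] using h

omit [LinearOrder R] [IsStrictOrderedRing R] in
/-- `P(T′ ∩ {a₁ ↔ u} ∩ {a₁ ↔ v}) = q P(T′(o) ∩ {o ↔ u} ∩ {o ↔ v})`. -/
lemma prob_T'_inter_LL {u v : V} (hu : u ≠ a₁) (hv : v ≠ a₁) :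
    prob p (TEvent ends a₂ a₁ a₃ ∩ (connEvent ends a₁ u ∩ connEvent ends a₁ v)) =
      p f * prob p (TEvent ends a₂ o a₃ ∩ (connEvent ends o u ∩ connEvent ends o v)) := by
  have h := RootLeafA3.prob_split p
    (A := TEvent ends a₂ a₁ a₃ ∩ (connEvent ends a₁ u ∩ connEvent ends a₁ v))
    ((free_T'1 hf hleaf h1o h12 h13).inter
      ((free_connEvent hf hleaf h1o (Ne.symm h1o) hu).inter
        (free_connEvent hf hleaf h1o (Ne.symm h1o) hv))) (A₀ := ∅)
    (by intro ω ω' _; rfl) ?_ ?_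
  · rw [h, prob_empty, mul_zero, add_zero]
  · ext ω
    simp only [Set.mem_inter_iff, mem_openEdge]
    constructor <;> rintro ⟨⟨h, hcu, hcv⟩, hω⟩ <;>
      exact ⟨⟨by simpa only [mem_T'_open hf a₂ a₃ hω] using h,
        by simpa only [RootLeafA3.mem_connL_open hf u hω] using hcu,
        by simpa only [RootLeafA3.mem_connL_open hf v hω] using hcv⟩, hω⟩
  · ext ω
    simp only [Set.mem_inter_iff, mem_closedEdge, Set.mem_empty_iff_false, false_and,
      iff_false, not_and]
    intro h hω
    exact mem_T'_closed hf hleaf h1o a₂ h13 hω h.1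

end Masses

end RootLeafO

end Summit.Ventures.PercRepro2
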